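import Summits.QuantumFields.GaugeBoot.SU2WeakCouplingRate
import HarnessLib

/-!
# Gauge-boot: the weak-coupling rate for `SU(2)` UNIFORMLY IN THE VOLUME —
# `1 − ⟨ū_P⟩_{β_std,L} ≤ 2·(1 + (2/(D−1))·(log 4096 + 2 log(β_std/2)))/β_std` for every torus
# (large-`N` supplement 17, part 10)

HONEST FRAMING (cell `pub-gaugeboot`, page 1 of every file): certified bounds on lattice
expectations at STATED coupling, gauge group, dimension and torus size; NOT a mass gap, NOT a
continuum limit, NOT a string tension, NOT large `N`; NOT Yang–Mills-summit-bearing (barriers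
`FixedCouplingUltralocality`, `PerturbativeInvisibility`).  An asymptotic statement: at the cell's
couplings (`β_std ≤ 10`) the right-hand side exceeds `1` and says nothing; its content is the
`L`-INDEPENDENT `O(log β/β)` decay, valid therefore for every infinite-volume limit point too.  The true
rate is `O(1/β)`; no number of the cell's tables is certified here.

## Content

Part 9 (`SU2WeakCouplingRate`) chose the Laplace radius `ε ≤ 1` and got constants `∝ |E|·log #P`.  Choosing
`ε = #P/β` instead (the small-ball bound holds up to `ε ≤ 4·#P`, `le_measureReal_wilsonAction_le_of_le`)
the `log #P` CANCELS and only the ratio `|E|/#P = 2/(D−1)` (`card_edge_mul_pred_eq`: `(D−1)·|E| = 2·#P`,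
from `2·#{i<j} = D(D−1)`) survives:

* ★★ `su2_wilsonExpectation_wilsonAction_le_uniform` — `⟨S⟩_{β,L} ≤ (2·#P + 2|E| log 4096 + 4|E| log β)/β`
  (tree coupling `β ≥ 1`);
* ★★★ `one_sub_wilsonExpectation_meanPlaquette_le_uniform` — `1 − ⟨ū_P⟩_{β,L} ≤ (1 + (2/(D−1))(log 4096 + 2 log β))/β`;
* ★★★ `one_sub_plaquetteExpectation_two_le_uniform` — **for `SU(2)`, every `D ≥ 2`, EVERY torus side `L`
  and every `β_std ≥ 2`: `1 − plaquetteExpectation 2 D L β_std ≤ 2·(1 + (2/(D−1))·(log 4096 + 2·log(β_std/2)))/β_std`**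
  — a bound with NO dependence on `L`.

[folklore] (Laplace principle + Gibbs–Jensen, with the one-link small-ball estimate of the lane's `SU2HaarSmallBall`.)
-/

noncomputable section

open MeasureTheory Filter Topology
open Literature.MathematicalPhysics.QuantumFieldTheory
open Literature.MathematicalPhysics.QuantumLattice (le_haarProbability_su2_two_sub_trace_le fundamentalRep_apply)

namespace Summit.QuantumFields.GaugeBoot

namespace SU2Rate

/-! ## Counting links and plaquettes: `(D − 1)·|E| = 2·#P` -/

/-- `|E| = |Λ|·d` (a link is a site and an axis). [folklore] -/
theorem card_edge_eq (d L : ℕ) [NeZero L] : Fintype.card (Edge d L) = Fintype.card (Site d L) * d := by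
  rw [Fintype.card_prod, Fintype.card_fin]

/-- `2·#{(i,j) : i < j} = d(d−1)` (ordered pairs split by trichotomy). [folklore] -/
theorem two_mul_card_ltPair (d : ℕ) : 2 * Fintype.card {p : Fin d × Fin d // p.1 < p.2} = d * (d - 1) := by
  classical
  have hA : Fintype.card {p : Fin d × Fin d // p.1 < p.2} = ∑ p : Fin d × Fin d, if p.1 < p.2 then 1 else 0 := by
    rw [Fintype.card_subtype, Finset.card_filter]
  have hB : (∑ p : Fin d × Fin d, if p.2 < p.1 then 1 else 0) = ∑ p : Fin d × Fin d, if p.1 < p.2 then 1 else 0 :=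
    Fintype.sum_equiv (Equiv.prodComm (Fin d) (Fin d)) _ _ fun p => rfl
  have hC : (∑ p : Fin d × Fin d, if p.1 = p.2 then 1 else 0) = d := by
    rw [Fintype.sum_prod_type]
    simp
  have htot : (∑ p : Fin d × Fin d, ((if p.1 < p.2 then 1 else 0) + (if p.2 < p.1 then 1 else 0) + (if p.1 = p.2 then 1 else 0)))
      = d * d := by
    have h1 : ∀ p : Fin d × Fin d, ((if p.1 < p.2 then 1 else 0) + (if p.2 < p.1 then 1 else 0) + (if p.1 = p.2 then 1 else 0)) = 1 := by
      intro p
      rcases lt_trichotomy p.1 p.2 with h | h | h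
      · simp [h, h.ne, h.le]
      · simp [h]
      · simp [h, h.ne', h.le]
    simp only [h1, Finset.sum_const, Finset.card_univ, Fintype.card_prod, Fintype.card_fin, smul_eq_mul, mul_one]
  rw [Finset.sum_add_distrib, Finset.sum_add_distrib, hB, hC, ← hA] at htot
  set A := Fintype.card {p : Fin d × Fin d // p.1 < p.2}
  have h2 : 2 * A + d = d * d := by linarith [htot]
  rw [Nat.mul_sub_one]
  generalize d * d = X at h2 ⊢
  omega

/-- `#P = |Λ|·#{i<j}`. [folklore] -/
theorem card_plaquette_eq (d L : ℕ) [NeZero L] :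
    Fintype.card (Plaquette d L) = Fintype.card (Site d L) * Fintype.card {p : Fin d × Fin d // p.1 < p.2} :=
  Fintype.card_prod _ _

/-- ★ **`(d − 1)·|E| = 2·#P`**: links per plaquette do not depend on the volume. [folklore] -/
theorem card_edge_mul_pred_eq (d L : ℕ) [NeZero L] : (d - 1) * Fintype.card (Edge d L) = 2 * Fintype.card (Plaquette d L) := by
  rw [card_edge_eq, card_plaquette_eq]
  have h := two_mul_card_ltPair d
  calc (d - 1) * (Fintype.card (Site d L) * d) = Fintype.card (Site d L) * (d * (d - 1)) := by ring
    _ = Fintype.card (Site d L) * (2 * Fintype.card {p : Fin d × Fin d // p.1 < p.2}) := by rw [h]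
    _ = 2 * (Fintype.card (Site d L) * Fintype.card {p : Fin d × Fin d // p.1 < p.2}) := by ring

/-- The ratio in `ℝ`: `|E| = (2/(d−1))·#P` for `d ≥ 2`. [folklore] -/
theorem card_edge_eq_div (d L : ℕ) [NeZero L] (hd : 2 ≤ d) :
    (Fintype.card (Edge d L) : ℝ) = 2 / ((d : ℝ) - 1) * Fintype.card (Plaquette d L) := by
  have h := card_edge_mul_pred_eq d L
  have hd' : (0 : ℝ) < (d : ℝ) - 1 := by
    have : (2 : ℝ) ≤ d := by exact_mod_cast hd
    linarith
  have hcast : ((d : ℝ) - 1) * Fintype.card (Edge d L) = 2 * Fintype.card (Plaquette d L) := by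
    have := congrArg (fun n : ℕ => (n : ℝ)) h
    push_cast [Nat.cast_sub (by omega : 1 ≤ d)] at this
    linarith
  field_simp
  linarith

/-! ## The small-ball bound up to `ε ≤ 4·#P` -/

section Torus

variable {d L : ℕ}

/-- The `SU(2)` small-ball bound of part 9, for all `0 < ε ≤ 4·#P` (the one-link bound needs only
`η = ε/(16 #P) ≤ 1/4`). [folklore] -/
theorem le_measureReal_wilsonAction_le_of_le [NeZero L] [Nonempty (Plaquette d L)] {ε : ℝ} (hε0 : 0 < ε)
    (hε : ε ≤ 4 * Fintype.card (Plaquette d L)) :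
    ((4096 : ℝ) * (Fintype.card (Plaquette d L) : ℝ) ^ 2)⁻¹ ^ Fintype.card (Edge d L) * ε ^ (2 * Fintype.card (Edge d L)) ≤
      (Measure.pi fun _ : Edge d L => haarProbability (SU 2)).real
        {U : GaugeConfig d L (SU 2) | wilsonAction (suRep 2) U ≤ ε} := by
  haveI : IsProbabilityMeasure (haarProbability (SU 2)) :=
    ⟨by simpa [haarProbability] using Measure.haarMeasure_self (G := SU 2) (K₀ := ⊤)⟩
  set P : ℝ := (Fintype.card (Plaquette d L) : ℝ) with hPdef
  have hP : (1 : ℝ) ≤ P := by rw [hPdef]; exact_mod_cast Fintype.card_pos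
  set η : ℝ := ε / (16 * P) with hη
  have hη0 : 0 < η := by positivity
  have hη4 : η ≤ 1 / 4 := by
    rw [hη, div_le_iff₀ (by positivity)]; nlinarith
  set T : Set (SU 2) := {g : SU 2 | 2 - ((g : Matrix (Fin 2) (Fin 2) ℂ).trace).re ≤ η} with hT
  set A : Set (GaugeConfig d L (SU 2)) := Set.pi Set.univ fun _ : Edge d L => T with hA
  set π₀ := Measure.pi fun _ : Edge d L => haarProbability (SU 2) with hπ₀
  have hsub : A ⊆ {U : GaugeConfig d L (SU 2) | wilsonAction (suRep 2) U ≤ ε} := by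
    intro U hUA
    have hU : ∀ e : Edge d L, 2 - (((U e : SU 2)) : Matrix (Fin 2) (Fin 2) ℂ).trace.re ≤ η := fun e => hUA e (Set.mem_univ e)
    have h := wilsonAction_le_of_links U hU
    have : 16 * η * P = ε := by rw [hη]; field_simp
    show wilsonAction (suRep 2) U ≤ ε
    rw [← this]; exact h
  have hπA : ENNReal.ofReal ((η ^ 2 / 16) ^ Fintype.card (Edge d L)) ≤ π₀ A := by
    rw [hπ₀, hA, Measure.pi_pi, Finset.prod_const, Finset.card_univ, ENNReal.ofReal_pow (by positivity)]
    exact pow_le_pow_left' (le_haarProbability_su2_two_sub_trace_le hη0 hη4) _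
  have hfin : π₀ {U : GaugeConfig d L (SU 2) | wilsonAction (suRep 2) U ≤ ε} ≠ ⊤ := measure_ne_top _ _
  have hreal : (η ^ 2 / 16) ^ Fintype.card (Edge d L) ≤ π₀.real {U : GaugeConfig d L (SU 2) | wilsonAction (suRep 2) U ≤ ε} := by
    rw [measureReal_def, ← ENNReal.ofReal_le_iff_le_toReal hfin]
    exact hπA.trans (measure_mono hsub)
  have harith : ((4096 : ℝ) * P ^ 2)⁻¹ ^ Fintype.card (Edge d L) * ε ^ (2 * Fintype.card (Edge d L)) =
      (η ^ 2 / 16) ^ Fintype.card (Edge d L) := by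
    rw [pow_mul, ← mul_pow]
    congr 1
    rw [hη]
    field_simp
    ring
  rw [harith]
  exact hreal

/-- ★★ **Uniform weak-coupling bound on the mean action**: for `SU(2)`, every torus with plaquettes and
tree coupling `β ≥ 1`: `⟨S⟩_{β,L} ≤ (2·#P + 2|E|·log 4096 + 4|E|·log β)/β` (Laplace radius `ε = #P/β`:
the `log #P` of part 9 cancels). [folklore] -/
theorem su2_wilsonExpectation_wilsonAction_le_uniform [NeZero L] [Nonempty (Plaquette d L)] {β : ℝ} (hβ : 1 ≤ β) :
    wilsonExpectation (suRep 2) β (wilsonAction (d := d) (L := L) (G := SU 2) (suRep 2)) ≤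
      (2 * Fintype.card (Plaquette d L) + 2 * Fintype.card (Edge d L) * Real.log 4096
        + 4 * Fintype.card (Edge d L) * Real.log β) / β := by
  set P : ℝ := (Fintype.card (Plaquette d L) : ℝ) with hPdef
  set E : ℕ := Fintype.card (Edge d L) with hEdef
  have hP : (1 : ℝ) ≤ P := by rw [hPdef]; exact_mod_cast Fintype.card_pos
  have hβ0 : 0 < β := by linarith
  have hε0 : 0 < P / β := by positivity
  have hε : P / β ≤ 4 * Fintype.card (Plaquette d L) := by
    rw [← hPdef, div_le_iff₀ hβ0]; nlinarith
  have h := wilsonExpectation_wilsonAction_le_laplace (d := d) (L := L) (suRep 2) (continuous_suRep 2)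
    (re_trace_le_of_continuous (suRep 2) (continuous_suRep 2)) hβ0 hε0
  set p : ℝ := (Measure.pi fun _ : Edge d L => haarProbability (SU 2)).real
    {U : GaugeConfig d L (SU 2) | wilsonAction (suRep 2) U ≤ P / β} with hp
  have hsb : ((4096 : ℝ) * P ^ 2)⁻¹ ^ E * (P / β) ^ (2 * E) ≤ p := le_measureReal_wilsonAction_le_of_le hε0 hε
  have hc : (0 : ℝ) < ((4096 : ℝ) * P ^ 2)⁻¹ ^ E * (P / β) ^ (2 * E) := by positivity
  -- `-log p ≤ E log 4096 + 2E log β` (the `log P` cancels)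
  have hlog : -Real.log p ≤ E * Real.log 4096 + 2 * E * Real.log β := by
    have h1 := Real.log_le_log hc hsb
    rw [Real.log_mul (by positivity) (by positivity), Real.log_pow, Real.log_pow, Real.log_inv,
      Real.log_mul (by norm_num) (by positivity), Real.log_pow, Real.log_div (by positivity) hβ0.ne'] at h1
    push_cast at h1
    linarith
  have h2 : 2 * (P / β) - 2 / β * Real.log p ≤ (2 * P + 2 * E * Real.log 4096 + 4 * E * Real.log β) / β := by
    rw [show 2 * (P / β) - 2 / β * Real.log p = (2 * P + 2 * (-Real.log p)) / β by ring]
    exact div_le_div_of_nonneg_right (by linarith) hβ0.le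
  exact h.trans h2

/-- ★★★ **Uniform rate for the mean plaquette**: for `SU(2)`, `d ≥ 2`, EVERY `L` and tree coupling `β ≥ 1`:
`1 − ⟨ū_P⟩_{β,L} ≤ (1 + (2/(d−1))·(log 4096 + 2·log β))/β` — no dependence on `L`. [folklore] -/
theorem one_sub_wilsonExpectation_meanPlaquette_le_uniform [NeZero L] (hd : 2 ≤ d) {β : ℝ} (hβ : 1 ≤ β) :
    1 - wilsonExpectation (suRep 2) β (meanPlaquette (d := d) (L := L) (G := SU 2) (suRep 2)) ≤
      (1 + 2 / ((d : ℝ) - 1) * (Real.log 4096 + 2 * Real.log β)) / β := by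
  haveI := nonempty_plaquette_of_two_le (L := L) hd
  rw [wilsonExpectation_meanPlaquette_eq (suRep 2) (continuous_suRep 2) (by norm_num : (2 : ℕ) ≠ 0), sub_sub_cancel]
  have hP : (0 : ℝ) < Fintype.card (Plaquette d L) := by exact_mod_cast Fintype.card_pos
  have hβ0 : 0 < β := by linarith
  have h := su2_wilsonExpectation_wilsonAction_le_uniform (d := d) (L := L) hβ
  rw [card_edge_eq_div d L hd] at h
  have hd' : (0 : ℝ) < (d : ℝ) - 1 := by
    have : (2 : ℝ) ≤ d := by exact_mod_cast hd
    linarith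
  rw [div_le_iff₀ (by positivity)]
  calc wilsonExpectation (suRep 2) β (wilsonAction (d := d) (L := L) (G := SU 2) (suRep 2))
      ≤ (2 * Fintype.card (Plaquette d L) + 2 * (2 / ((d : ℝ) - 1) * Fintype.card (Plaquette d L)) * Real.log 4096
          + 4 * (2 / ((d : ℝ) - 1) * Fintype.card (Plaquette d L)) * Real.log β) / β := h
    _ = (1 + 2 / ((d : ℝ) - 1) * (Real.log 4096 + 2 * Real.log β)) / β * ((2 : ℕ) * Fintype.card (Plaquette d L)) := by
          push_cast
          field_simp
          ring

/-- ★★★ **The cell's form, uniform in the volume**: for `SU(2)`, every `D ≥ 2`, EVERY torus side `L` and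
every `β_std ≥ 2`:
`1 − plaquetteExpectation 2 D L β_std ≤ 2·(1 + (2/(D−1))·(log 4096 + 2·log(β_std/2)))/β_std`. [folklore] -/
theorem one_sub_plaquetteExpectation_two_le_uniform {D L : ℕ} [NeZero L] (hD : 2 ≤ D) {β : ℝ} (hβ : 2 ≤ β) :
    1 - plaquetteExpectation 2 D L β ≤ 2 * (1 + 2 / ((D : ℝ) - 1) * (Real.log 4096 + 2 * Real.log (β / 2))) / β := by
  have hβ' : (1 : ℝ) ≤ β / (2 : ℕ) := by rw [Nat.cast_ofNat, le_div_iff₀ (by norm_num : (0 : ℝ) < 2)]; linarith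
  have h := one_sub_wilsonExpectation_meanPlaquette_le_uniform (d := D) (L := L) hD hβ'
  unfold plaquetteExpectation
  refine h.trans (le_of_eq ?_)
  have hβ0 : 0 < β := by linarith
  push_cast
  field_simp

end Torus

end SU2Rate

end Summit.QuantumFields.GaugeBoot

end
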